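import Summits.QuantumFields.QCD.Theses.QuarksAsStableAction
import Literature.MathematicalPhysics.QuantumFieldTheory.QCDTimeReflection
import Literature.MathematicalPhysics.QuantumFieldTheory.QCDTransferMatrix
import Literature.MathematicalPhysics.QuantumFieldTheory.QCDGoldstoneBound
import Summits.QuantumFields.QCD.Theorems.QuarksAsStableActionStableActionBridgeTorusDenominator
import Summits.QuantumFields.QCD.Theorems.QuarksAsStableActionStableActionBridgeTorusDenominatorAP
import Summits.QuantumFields.QCD.Theorems.QuarksAsStableActionStableActionBridgeTransferLevelBounds
import Summits.QuantumFields.QCD.Theorems.QuarksAsStableActionStableActionBridgeFermionSliceContinuous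
import Summits.QuantumFields.QCD.Theorems.QuarksAsStableActionStableActionBridgeFermionSliceOpCovariance
import Summits.QuantumFields.QCD.Theorems.QuarksAsStableActionStableActionBridgeSliceKernelInvariance
import Summits.QuantumFields.QCD.Theorems.QuarksAsStableActionStableActionBridgeSliceGaugeUnitarity
import Summits.QuantumFields.QCD.Theorems.QuarksAsStableActionStableActionBridgeStubCyclicPeelC
import Summits.QuantumFields.QCD.Theorems.QuarksAsStableActionStableActionBridgeStubSpectralTraceC
import Summits.QuantumFields.QCD.Theorems.QuarksAsStableActionStableActionBridgeStubFermionSliceOpSqrt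
import Summits.QuantumFields.QCD.Theorems.QuarksAsStableActionStableActionBridgeStubBondKernelStar
import Summits.QuantumFields.QCD.Theorems.QuarksAsStableActionStableActionBridgeStubBondKernelContinuous
import Summits.QuantumFields.QCD.Theorems.QuarksAsStableActionStableActionBridgeStubRayleighOfInvariant
import Summits.QuantumFields.QCD.Theorems.QuarksAsStableActionStableActionBridgeStubCyclicScalarise
import Summits.QuantumFields.QCD.Theorems.QuarksAsStableActionStableActionBridgeStubInnerLeOfEigenLe
import Summits.QuantumFields.QCD.Theorems.QuarksAsStableActionStableActionBridgeStubScalarKernelProps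
import Summits.QuantumFields.QCD.Theorems.QuarksAsStableActionStableActionBridgeStubEigenRayleigh
import Summits.QuantumFields.QCD.Theorems.QuarksAsStableActionStableActionBridgeStubRayleighLeOfEigenLe
import Summits.QuantumFields.QCD.Theorems.QuarksAsStableActionStableActionBridgeStubJointEigenbasisInvolution
import Summits.QuantumFields.QCD.Theorems.QuarksAsStableActionStableActionBridgeStubMulInvolutionOp
import Summits.QuantumFields.QCD.Theorems.QuarksAsStableActionStableActionBridgeStubExistsTopIndex
import Summits.QuantumFields.QCD.Theorems.QuarksAsStableActionStableActionBridgeStubLevelZeroEqEigenmax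
import Summits.QuantumFields.QCD.Theorems.QuarksAsStableActionStableActionBridgeStubDenominatorComparison
import Summits.QuantumFields.QCD.Theorems.QuarksAsStableActionStableActionBridgeStubTorusDenominatorsSpectral
import Summits.QuantumFields.QCD.Theorems.QuarksAsStableActionStableActionBridgeStubThermalTracesSpectral
import Summits.QuantumFields.QCD.Theorems.QuarksAsStableActionStableActionBridgeStubCyclicScalariseSlices
import Summits.QuantumFields.QCD.Theorems.QuarksAsStableActionStableActionBridgeStubModeNumberSelection
import Summits.QuantumFields.QCD.Theorems.QuarksAsStableActionStableActionBridgeStubFermionSliceMatrixChargeConj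
import Summits.QuantumFields.QCD.Theorems.QuarksAsStableActionStableActionBridgeStubFockLiftComplement
import Summits.QuantumFields.QCD.Theorems.QuarksAsStableActionStableActionBridgeStubSliceDataSuConj
import Summits.QuantumFields.QCD.Theorems.QuarksAsStableActionStableActionBridgeStubSpectralTraceInsertC
import Summits.QuantumFields.QCD.Theorems.QuarksAsStableActionStableActionBridgeStubNumeratorComparison
import Summits.QuantumFields.QCD.Theorems.QuarksAsStableActionStableActionBridgeStubFockGaugeActChargeConj
import Summits.QuantumFields.QCD.Theorems.QuarksAsStableActionStableActionBridgeStubFermionSliceOpChargeConj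
import Summits.QuantumFields.QCD.Theorems.QuarksAsStableActionStableActionBridgeStubBondKernelChargeConj
import Summits.QuantumFields.QCD.Theorems.QuarksAsStableActionStableActionBridgeStubTransferWaveChargeConj
import Summits.QuantumFields.QCD.Theorems.QuarksAsStableActionStableActionBridgeStubEigenvectorToEigenwave
import Summits.QuantumFields.QCD.Theorems.QuarksAsStableActionStableActionBridgeStubEigenwaveToEigenvector
import Summits.QuantumFields.QCD.Theorems.QuarksAsStableActionStableActionBridgeStubSimpleOfTraceLt
import Summits.QuantumFields.QCD.Theorems.QuarksAsStableActionStableActionBridgeStubEigenspaceSimple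
import Summits.QuantumFields.QCD.Theorems.QuarksAsStableActionStableActionBridgeStubSectorOfSimple
import Summits.QuantumFields.QCD.Theorems.QuarksAsStableActionStableActionBridgeStubCardSliceFermiIdx
import Literature.MathematicalPhysics.QuantumLattice.CPeriodicBoundaryConditions
import Literature.Analysis.OperatorTheory.HermitianKernelOperator
import Literature.Analysis.OperatorTheory.CompactSelfAdjointEigenbasis
import Literature.Analysis.OperatorTheory.IntegralOperatorHilbertSchmidt
import Literature.Analysis.OperatorTheory.JointEigenbasis

/-!
# Line `twisted_trace_transfer` for crux `QuarksAsStableAction.StableActionBridge`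
# (item stmt-QuantumFields-9737, route route-QuantumFields-QuarksAsStableAction) — crux-plan skeleton

Idea card: `Cruxes/StableActionBridge/Ideas/twisted-trace-transfer.md` (ideator 1, round 1; triage r1: k1 fail / k2 pass /
k3 fail, merged with `twisted-trace-spine`; unanimous sharpening of the panel: "type the AP → P RETURN and the
low-temperature pressure clause ONCE").  Line card: `Lines/twisted_trace_transfer.md`.

## The cut

The crux is `StableActionBridge := UnquenchedChessboardBound → WilsonQuarkStability → QCD`; both hypotheses are theorems of
the tree (items 9735, 9736), so the crux is literally the conjunct `QCD = QCDOf 2 ∧ QCDOf 3` (`Sketch.stableActionBridge_iff_qcd`,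
p132266).  The card's `Transfer:` is `C⁺ := B_th ∧ LowTPressure ⟹ B`: construct the theory where Lüscher's transfer matrix is an
HONEST trace — quarks ANTIPERIODIC in Euclidean time — and return to the statement's time-PERIODIC functional (the
`(−1)^F`-TWISTED trace, QCDOS audit g8 N2) at the end, paying with the thermal smallness of the Boltzmann sum over excited
states.  Following the crux protocol ("a `Transfer:` becomes a stub"), the skeleton is:

* `stub_thermalQCD : ThermalConstruction` (`:= ∀ N_f ∈ {2,3}, ThermalQCDOf N_f`) — OPEN PROBLEM (the construction).  `ThermalQCDOf` is the conjunct
  `QCDOf` re-rendered on the THERMAL family the tree already has: the SAME odd tori `(2S+1)⁴`, the SAME Wilson gauge action and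
  `r = 1` Wilson quarks, but the fermionic Boltzmann factor `fermiBoltzmannAP` of `QCDTimeReflection` (antiperiodic temporal layer
  antipodal to `t = 0`; `qcdTorusExpectAP`), i.e. `Tr 𝕋^{2S+1}(·)/Tr 𝕋^{2S+1}` instead of `Str/Str`; PLUS the two physical clauses
  every construction on cubic tori owes and the return consumes: `LowTemperaturePressureAt` (the Boltzmann sum
  `Σ_{i≥1} (λᵢ/λ₀)^t` of Lüscher's transfer operator on the spatial torus of side `2S+1` is `≤ C e^{−Δ a_k t}` for `t ≥ θS`,
  typed SPECTRALLY over the tree's min–max levels `qcdTransferLevel` — the full gauge-invariant space, all baryon sectors) and a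
  thermal GOLDSTONE lower bound (`HasThermalGoldstoneBoundAt`, the antiperiodic twin of the tree's `HasGoldstoneBoundAt` with the
  dominance condition the return needs), and the bookkeeping clauses `IsEventuallyPhysical` (`β_k ≥ 0`, `m_f(k) > −1`: the
  range of Lüscher positivity) and `SubexponentialRenormalisation` (`|z_s(k)| + |shift_s(k)| ≤ e^{δ a_k L_k}` eventually, every
  `δ > 0` — a free choice of the volumes `L_k` for the constructor).  NOT the card's AP-in-all-four-axes EVEN tori: no axis
  induction, no parity step, no torus types the tree lacks; in exchange the route's A (9735, typed on even all-antiperiodic tori)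
  is NOT made consumable by this line (it is a theorem anyway).  WHY THIS FAMILY IS THE PLACE TO CONSTRUCT (and the only sense in
  which the stub is easier than `QCDOf`): configuration-wise site-reflection positivity holds on it (`WilsonQCDSiteReflectionPositivityAP`,
  named fact; Lüscher 1977, Montvay–Münster (4.111), Osterwalder–Seiler 1978), so the transfer matrix is positive, the normaliser is
  `Z_th = Tr 𝕋^{2S+1} > 0` (no junk-`0` branch of the torus functional), the lattice gap clause, the pressure clause and the Goldstone
  bound are SPECTRAL statements about one positive operator, and Källén–Lehmann positivity is available for the lower bounds.  The UV
  stability with dynamical Wilson quarks and the Yang–Mills infrared are NOT easier here — said plainly.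
* `stub_schwingerComparison : SchwingerReturn` — THE RETURN for the renormalised smeared `n`-point functions: under low-temperature pressure and
  subexponential renormalisations, `qcdLatticeSchwinger − qcdLatticeSchwingerThermal → 0` along the scheme (every arity, every
  species string, every tuple of real test functions).  Size XL: operator-level form of Lüscher's transfer matrix for the tree's
  functional (kernel level LANDED: `TorusDenominator` / `TorusDenominatorAP`, `SupertraceTransferForm`, `CyclicSupertrace`,
  `APTraceForm`, `TransferPositivity`, …, namespace `…Cruxes.StableActionBridge.Sketch`) + the landed finite-dimensional comparison
  `stub_twistedTraceComparison` (p103562) / `twisted_expectation_sub_vacuum_le(_of_le)` (p106608, p109817).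
* `stub_correlatorComparison : CorrelatorReturn` — THE RETURN for connected correlators of FIXED gauge-invariant lattice observables, uniformly on
  all tori `S ≥ L_k` and separations `n ≤ S`, with the honest wrap-around exponent: `‖corr_P − corr_th‖ ≤ C e^{−Δth a_k (2S+1−n)}`
  (the twisted/thermal defect decays in the length of the COMPLEMENTARY arc).  Size L/XL (same operator-level input; no
  renormalisation constants enter).

Between the pieces everything is PROVED here: the comparison of Schwinger
functions transfers `IsQCDAlongThermal ↦ IsQCDAlong` (`isQCDAlong_of_comparison`); the correlator comparison transfers the uniform
lattice gap `Δ ↦ min Δ Δth` (`hasLatticeMassGap_of_comparison`) and the Goldstone bound thermal ↦ periodic at the same rate with half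
the constant (`hasGoldstoneBoundAt_of_thermal`, whence `IsChiralAtZero` by the tree's `HasGoldstoneBound.isChiralAtZero`); and
`qcdOf_of_thermal : SchwingerReturn → CorrelatorReturn → ThermalQCDOf N_f → QCDOf N_f` assembles the conjunct.
`qcd_of_returns : ThermalConstruction → SchwingerReturn → CorrelatorReturn → QCD` takes the three stub STATEMENTS (named
`def … : Prop`) as hypotheses (sorry-free); `StableActionBridge_of : StableActionBridge` applies it to the stubs and concludes the crux BY NAME.

Disproof used: none exists for this crux (payload `disproof_path` absent on disk; `ledger crux ls stmt-QuantumFields-9737` lists no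
`Disproof.lean`, 2026-08-17T03:1xZ).  Negatives checked (`ledger negatives --problem QuantumFields`, 5 entries): none is about boundary
conditions / transfer matrices; lesson of 9599 (an `∃`-package with an unsatisfiable side clause is cheaply false) honoured — every
side clause of `ThermalQCDOf` is satisfiable in kind (see the docstrings: `θ > 0` free, dominance instead of `μ < Δth`).
Dead line `Sketch` (L5(iii)): its stubs were items 8794 ∧ 17394; this line's workable stubs are the two comparisons, not items.
-/

noncomputable section

open Filter Topology
open scoped SchwartzMap BigOperators
open Literature.MathematicalPhysics.AQFT Literature.MathematicalPhysics.QuantumLattice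
open Literature.MathematicalPhysics.QuantumFieldTheory
open Summit.QuantumFields.QCD.Theses.QuarksAsStableAction (UnquenchedChessboardBound WilsonQuarkStability
  StableActionBridge)

namespace Summit.QuantumFields.QCD.Cruxes.StableActionBridge.TwistedTraceTransfer

local notation "E4" => EuclideanSpace ℝ (Fin 4)

variable {Nf : ℕ}

/-! ## §1  Thermal (time-antiperiodic) twins of the statement's lattice functionals -/

/-- **Thermal lattice QCD `n`-point function** of the species string `σ` on real test functions `fᵢ` at step `k`: the tree's
`qcdLatticeSchwinger` with the fermionic Boltzmann factor `fermiBoltzmannAP` (quarks ANTIPERIODIC across the temporal layer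
antipodal to `t = 0`, Montvay–Münster (4.114)) in numerator and denominator — the honest thermal trace
`Tr[𝕋^{2L_k+1} ⋯]/Tr 𝕋^{2L_k+1}` of Lüscher's transfer-matrix formalism instead of the `(−1)^F`-twisted one.  Same gauge measure,
same smeared renormalised insertions. [cite: MontvayMunster1994, §4.1.3 (4.34) and §4.2.4 (4.112)–(4.115)] [cite: Luscher1977] -/
def qcdLatticeSchwingerThermal (sch : QCDScheme Nf) (k : ℕ) (n : ℕ) (σ : Fin n → QCDField Nf)
    (f : Fin n → 𝓢(E4, ℝ)) : ℂ :=
  (∫ U, fermiIntegral ((List.ofFn fun i => smearedInsertion sch k U (σ i) (f i)).prod *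
      fermiBoltzmannAP U fun fl => sch.mq fl k) ∂(qcdGaugeMeasure sch k)) /
    ∫ U, fermiIntegral (fermiBoltzmannAP U fun fl => sch.mq fl k) ∂(qcdGaugeMeasure sch k)

/-- **`IsQCDAlongThermal sch T`**: verbatim `IsQCDAlong` (two-loop asymptotic scaling, bare masses eventually on the physical
branch, convergence of the lattice `n`-point functions to `𝔖ₙ^σ` on off-diagonal real tensors along the full sequence) with the
THERMAL lattice functional `qcdLatticeSchwingerThermal`. [cite: OsterwalderSeiler1978] [cite: JaffeWitten2000, §5] -/
def IsQCDAlongThermal (sch : QCDScheme Nf) (T : OSData (QCDField Nf) 4) : Prop :=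
  sch.HasAsymptoticScaling ∧
    (∀ fl : Fin Nf, ∀ᶠ k in atTop, -1 < sch.mq fl k) ∧
    ∀ (n : ℕ), n ≠ 0 → ∀ (σ : Fin n → QCDField Nf) (f : Fin n → 𝓢(E4, ℝ)) (F : 𝓢((Fin n → E4), ℂ)),
      IsTensorOf F (fun i => ofRealTest (f i)) → IsOffDiagonal F →
        Tendsto (fun k : ℕ => qcdLatticeSchwingerThermal sch k n σ f) atTop (𝓝 (T.schwinger n σ F))

/-- **Thermal connected Euclidean-time correlation** `⟨A(0)·B(n e₀)⟩_th − ⟨A⟩_th⟨B⟩_th` of two gauge-invariant local lattice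
observables on the torus of side `S`: the tree's `qcdLatticeConnectedCorr` with `qcdTorusExpectAP` in place of `qcdTorusExpect`.
[cite: MontvayMunster1994, §4.1.3 (4.34)] [cite: OsterwalderSeiler1978, §§2–4] -/
def qcdLatticeConnectedCorrThermal {R R' : ℕ} (β : ℝ) (S : ℕ) [NeZero S] (mq : Fin Nf → ℝ)
    (A : QCDLatticeObservable Nf R) (B : QCDLatticeObservable Nf R') (n : ℕ) : ℂ :=
  qcdTorusExpectAP β S mq (fun U => A.onTorus S 0 U * B.onTorus S (Pi.single 0 (n : ℤ)) U) -
    qcdTorusExpectAP β S mq (A.onTorus S 0) * qcdTorusExpectAP β S mq (B.onTorus S (Pi.single 0 (n : ℤ)))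

/-- **Uniform THERMAL lattice mass gap `Δ`** along the scheme: verbatim `QCDScheme.HasLatticeMassGap` (all pairs of
gauge-invariant local observables, every torus `2S+1 ≥ 2L_k+1`, every separation `n ≤ S`, one constant, eventually in `k`) for the
thermal connected correlation.  On this family the clause has its spectral meaning: by Lüscher positivity the thermal functional is
`Tr[𝕋^{2S+1−n} Â 𝕋ⁿ B̂]/Tr 𝕋^{2S+1}` for a positive self-adjoint `𝕋` on the full gauge-invariant space.
[cite: Luscher1977] [cite: JaffeWitten2000, §5] -/
def HasThermalLatticeMassGap (sch : QCDScheme Nf) (Δ : ℝ) : Prop :=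
  ∀ (R R' : ℕ) (A : QCDLatticeObservable Nf R) (B : QCDLatticeObservable Nf R'), ∃ C : ℝ,
    ∀ᶠ k in atTop, ∀ S : ℕ, sch.L k ≤ S → ∀ n : ℕ, n ≤ S →
      ‖qcdLatticeConnectedCorrThermal (sch.β k) (2 * S + 1) (fun fl => sch.mq fl k) A B n‖ ≤
        C * Real.exp (-(Δ * (sch.a k * n)))

/-! ## §2  The infrared clause: low-temperature pressure (thermal smallness), typed spectrally -/

/-- **Thermal trace of lattice QCD in transfer form on the asymmetric torus `(m+2) × S³`** (lead c17, reshape r1 of the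
line): `Θ_{m+2}(β, m, S) = ∫∫ ∏_{t : Fin (m+2)} K_β(U_t, U_{t+1}^{g_t}) · Tr ∏_t T̂_F(U_t) Γ(G_{g_t}) dU dg` — `m + 2` time slices of
spatial side `S`, the Wilson gauge kernel in temporal gauge, Smit's fermionic transfer operator and the Gauss-law Haar integrals over the
temporal links; up to the Berezin sign and `Z_W` this is the antiperiodic (thermal) fermionic partition function of the asymmetric torus,
which the tree has no torus type for.  By E3 (`stub_torusDenominators_spectral` at `m + 2 = S`, and its all-extent form) it equals
`Σᵢ λᵢ^{m+2}` over the eigenvalues of Lüscher's positive transfer operator on the gauge-invariant space, so `Θ_t / λ_{i₀}^t − 1 ≥ 0` is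
the honest thermal excess (Boltzmann sum over excited states). [cite: Luscher1977, pp. 283–292] [cite: MontvayMunster1994, §4.1.3 (4.34)] -/
def qcdThermalTrace (Nf S : ℕ) [NeZero S] (β : ℝ) (mq : Fin Nf → ℝ) (m : ℕ) : ℂ :=
  ∫ p : (Fin (m + 2) → GaugeConfig 3 S (Matrix.specialUnitaryGroup (Fin 3) ℂ)) ×
      (Fin (m + 2) → Literature.Probability.LatticeModels.TorusSite 3 S → Matrix.specialUnitaryGroup (Fin 3) ℂ),
    ((∏ t : Fin (m + 2), gaugeSliceKernel β (p.1 t) (gaugeTransform (p.2 t) (p.1 (t + 1))) : ℝ) : ℂ) *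
      ((List.ofFn fun t : Fin (m + 2) => fermionSliceOp (p.1 t) mq * @fockGaugeAct Nf S _ (p.2 t)).prod).trace
    ∂((MeasureTheory.Measure.pi fun _ : Fin (m + 2) => sliceHaar S).prod
        (MeasureTheory.Measure.pi fun _ : Fin (m + 2) => MeasureTheory.Measure.pi fun _ : Literature.Probability.LatticeModels.TorusSite 3 S =>
          haarProbability (Matrix.specialUnitaryGroup (Fin 3) ℂ)))

/-- **Low-temperature pressure bound at rate `Δth`, typed at TRACE level** (lead c17, reshape r1; the card's thermal smallness `ThS`):
for every aspect parameter `θ > 0` there is `C` such that eventually in `k`, on every spatial torus of side `2S+1 ≥ 2L_k+1` and for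
every Euclidean extent `t = m + 2 ≥ θ S`, the thermal trace is at most `(1 + C e^{−Δth a_k t}) · λ₀^t`, `λ₀ = qcdTransferLevel … 0` the top
min–max level (= the vacuum eigenvalue of the transfer operator, `stub_levelZero_eq_eigenmax`), i.e. the Boltzmann sum over EXCITED
states `Σ_{i ≠ i₀} (λᵢ/λ₀)^t = Θ_t/λ₀^t − 1 ≤ C e^{−Δth a_k t}`.  This is EQUIVALENT to the planner's spectral typing over all min–max levels
given E3, but consumes only level `0` (no Courant–Fischer for the higher levels is needed in the returns); it still forces a SIMPLE top
eigenvalue for large `t`.  Reading and honesty exactly as before: `log Θ_t − t log λ₀` is the volume times the pressure of the excitations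
at temperature `1/(a_k t)`; for a massive theory the sum is `≲ (a_k S)³ (m/(a_k t))^{3/2} e^{−m a_k t} ≤ C_θ e^{−Δth a_k t}` for `t ≥ θ S`
and any `Δth < m`; `∀ θ > 0` keeps the temperature `→ 0` (`FiniteTemperatureDeconfinement` never entered); FULL trace (all baryon
sectors, `Δth ≤ m_N`). [cite: Luscher1977] [cite: FriedliVelenik2017, Ch. 5] [cite: MontvayMunster1994, §4.1.3] -/
def LowTemperaturePressureAt (sch : QCDScheme Nf) (Δth : ℝ) : Prop :=
  ∀ θ : ℝ, 0 < θ → ∃ C : ℝ, ∀ᶠ k in atTop, ∀ S : ℕ, sch.L k ≤ S → ∀ m : ℕ, θ * S ≤ (m + 2 : ℕ) →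
    (qcdThermalTrace Nf (2 * S + 1) (sch.β k) (fun fl => sch.mq fl k) m).re ≤
      (1 + C * Real.exp (-(Δth * (sch.a k * (m + 2 : ℕ))))) *
        qcdTransferLevel Nf (2 * S + 1) (sch.β k) (fun fl => sch.mq fl k) 0 ^ (m + 2)

/-- **Eventually physical couplings**: `β_k ≥ 0` and all bare Wilson masses `m_f(k) > −1` (`κ_f < 1/6`) eventually — the range in
which the Wilson gauge kernel and Lüscher's fermionic transfer matrix are positive (landed `isPosDefKernel_gaugeSliceKernel`,
`fermionSliceOp_posDef`) and the min–max levels are not junk.  (Implied by two-loop asymptotic scaling and the physical-branch clause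
of `IsQCDAlong`; kept as an explicit clause so that the comparison stubs are self-contained scheme-level statements.)
[cite: MontvayMunster1994, §4.2.3 (4.111)] -/
def IsEventuallyPhysical (sch : QCDScheme Nf) : Prop :=
  (∀ᶠ k in atTop, 0 ≤ sch.β k) ∧ ∀ fl : Fin Nf, ∀ᶠ k in atTop, -1 < sch.mq fl k

/-- **Subexponential renormalisations**: the species renormalisation constants grow slower than any exponential of the physical
volume side, `|z_s(k)| + |shift_s(k)| ≤ e^{δ a_k L_k}` eventually, for every `δ > 0`.  True for honest schemes (`z_s`, `shift_s` are
powers of `a_k⁻¹` times logarithms) as soon as the volumes are chosen with `log a_k⁻¹ = o(a_k L_k)` — a free choice for the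
constructor; it is what lets the operator-norm form of the twisted-trace comparison absorb the renormalisation constants of `n`
smeared insertions into the thermal factor `e^{−Δth θ a_k(2L_k+1)}`. [folklore] -/
def SubexponentialRenormalisation (sch : QCDScheme Nf) : Prop :=
  ∀ (s : QCDField Nf) (δ : ℝ), 0 < δ →
    ∀ᶠ k in atTop, |sch.z s k| + |sch.shift s k| ≤ Real.exp (δ * (sch.a k * sch.L k))

/-! ## §3  The chiral clause on the thermal family -/

/-- **Thermal Goldstone lower bound at rate `ε`** of a mass-independent regularisation — the antiperiodic twin of the tree's
`QCDRegularisation.HasGoldstoneBoundAt` with the two clauses the return needs: at some POSITIVE mass tuple `m` there are a rate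
`μ < ε`, a constant `c > 0`, a thermal rate `Δth > 0` with `IsEventuallyPhysical` and `LowTemperaturePressureAt … Δth` for the scheme
`reg.scheme m 0 0`, ONE pair of gauge-invariant local observables `A, B`, tori `S_k ≥ L_k` and separations `n_k ≤ S_k` with
`a_k n_k → ∞` such that EVENTUALLY `c e^{−μ a_k n_k} ≤ ‖⟨A · τ_{n_k e₀}B⟩^{conn}_{th; k, 2S_k+1}‖`, AND the DOMINANCE condition
`e^{−Δth a_k(2S_k+1−n_k)} / e^{−μ a_k n_k} → 0` (the thermal/twist defect on the complementary arc is negligible against the signal —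
the rate-weighted form of the familiar rule "read masses at `n < N/2` on a periodic lattice"; it is NECESSARY and honest: the
Goldstone channel decays at the finite-volume pion mass, `μ ≳ m_π`, while thermal smallness can only hold at `Δth < m_π`, so
`μ < Δth` would be unsatisfiable; with `n_k ≤ S_k/2`, `μ = 1.1 m_π`, `Δth = 0.9 m_π` the condition holds).  On the thermal family a
light pseudoscalar state of energy `E ≤ μ` gives the bound by spectral positivity (landed `vacuum_connected_lower_bound`).
[cite: MontvayMunster1994, §5.2.1 (5.93)–(5.96) and §5.3 (5.140)] [cite: GasserLeutwyler1984] -/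
def HasThermalGoldstoneBoundAt (reg : QCDRegularisation Nf) (ε : ℝ) : Prop :=
  ∃ m : Fin Nf → ℝ, (∀ f, 0 < m f) ∧ ∃ μ c Δth : ℝ, μ < ε ∧ 0 < c ∧ 0 < Δth ∧
    IsEventuallyPhysical (reg.scheme m 0 0) ∧ LowTemperaturePressureAt (reg.scheme m 0 0) Δth ∧
    ∃ (R R' : ℕ) (A : QCDLatticeObservable Nf R) (B : QCDLatticeObservable Nf R') (S n : ℕ → ℕ),
      (∀ k, reg.L k ≤ S k) ∧ (∀ k, n k ≤ S k) ∧ Tendsto (fun k => reg.a k * n k) atTop atTop ∧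
        Tendsto (fun k => Real.exp (-(Δth * (reg.a k * (2 * S k + 1 - n k)))) /
          Real.exp (-(μ * (reg.a k * n k)))) atTop (𝓝 0) ∧
        ∀ᶠ k in atTop, c * Real.exp (-(μ * (reg.a k * n k))) ≤
          ‖qcdLatticeConnectedCorrThermal (reg.β k) (2 * S k + 1) (fun fl => (reg.scheme m 0 0).mq fl k)
            A B (n k)‖

/-- **Thermal Goldstone bound**: the bound at every rate `ε > 0` — on the thermal family the statement "the pion mass tends to
zero with the quark mass" (Goldstone; `'t Hooft anomaly matching` if chiral symmetry were unbroken), the positive form of the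
conjunct's `IsChiralAtZero`. [cite: MontvayMunster1994, §5.3 (5.140)] [cite: GasserLeutwyler1984] -/
def HasThermalGoldstoneBound (reg : QCDRegularisation Nf) : Prop :=
  ∀ ε > (0 : ℝ), HasThermalGoldstoneBoundAt reg ε

/-! ## §4  The conjunct on the thermal family -/

variable (Nf) in
/-- **`ThermalQCDOf N_f` — QCD with `N_f` flavours constructed where the transfer matrix is an honest trace** (the statement of
`stub_thermalQCD`; OPEN PROBLEM): ONE mass-independent regularisation with leading-log mass scaling and the THERMAL Goldstone bound,
such that for EVERY positive renormalised mass tuple, along the bare trajectory with some species renormalisations, the scheme is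
eventually physical with subexponential renormalisations, there are OS data `T` that are the continuum limit of the THERMAL lattice
functional (`IsQCDAlongThermal`) with non-trivial non-Gaussian glue and dynamical quarks, and ONE rate `Δ > 0` at which the scheme has
low-temperature pressure, `T` has the OS mass gap and the THERMAL lattice functional has the uniform lattice gap.  It differs from
`QCDOf N_f` exactly in: thermal functionals (RP family) instead of twisted ones; the IR pressure clause and the Goldstone bound
(positive, subsequence-stable) instead of the negated clause `IsChiralAtZero`; two bookkeeping clauses.  Every clause is what any
construction on cubic tori delivers (Glimm–Jaffe §6.1 / OS II §4 format plus a convergent low-temperature expansion for the pressure);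
none is the conjunct reworded (`ThermalQCDOf N_f → QCDOf N_f` is the content of the two comparison stubs). [difficulty: open-problem]
[cite: JaffeWitten2000, §5] [cite: Luscher1977] [cite: OsterwalderSeiler1978] -/
def ThermalQCDOf : Prop :=
  ∃ reg : QCDRegularisation Nf, reg.HasMassScaling ∧ HasThermalGoldstoneBound reg ∧
    ∀ m : Fin Nf → ℝ, (∀ f, 0 < m f) →
      ∃ (z shift : QCDField Nf → ℕ → ℝ) (T : OSData (QCDField Nf) 4),
        IsEventuallyPhysical (reg.scheme m z shift) ∧ SubexponentialRenormalisation (reg.scheme m z shift) ∧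
        IsQCDAlongThermal (reg.scheme m z shift) T ∧ T.IsNontrivial QCDField.glue ∧ T.IsNonGaussian QCDField.glue ∧
        (∀ f g : Fin Nf, f ≠ g → T.IsNontrivial (QCDField.pseudoRe f g)) ∧
        ∃ Δ > 0, LowTemperaturePressureAt (reg.scheme m z shift) Δ ∧ T.HasMassGap Δ ∧
          HasThermalLatticeMassGap (reg.scheme m z shift) Δ

/-! ## §5  The three stub statements (named) and the registered stubs -/

/-- **Statement of stub 1 (OPEN PROBLEM — the construction on the reflection-positive family)**: `ThermalQCDOf N_f` for
`N_f = 2, 3`.  See `ThermalQCDOf`. [difficulty: open-problem] -/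
def ThermalConstruction : Prop :=
  ∀ Nf : ℕ, Nf = 2 ∨ Nf = 3 → ThermalQCDOf Nf

/-- **Statement of stub 2 (THE RETURN for Schwinger functions; XL).**  Along an eventually physical scheme with subexponential
renormalisations and low-temperature pressure at some rate `Δth > 0`, the twisted (statement's) and thermal lattice `n`-point
functions of the smeared renormalised fields have the same asymptotics: their difference tends to `0` for every arity `n ≥ 1`,
species string and tuple of real test functions.  Proof route: operator-level Lüscher transfer matrix for the tree's functional
(kernel level landed: cyclic (super)trace forms of both torus denominators, positivity of `T̂_F` and of the Wilson gauge kernel),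
each term of the expanded smeared product is a cyclic (super)trace with a free stretch of `𝕋`'s of length `≥ (2L_k+1)/(n+1) − O(1)`;
the landed comparison `|Tr(Γ Ô 𝕋ᴸ) − ⟨Ω,ÔΩ⟩| ≤ ‖Ô‖(Tr 𝕋ᴸ − 1)` (normalised, `Γ ∈ {1, (−1)^F}`) bounds twisted-minus-thermal by
`2‖Ô‖ ε_L/(1 − ε_L)`, `ε_L ≤ C e^{−Δth a_k L}` by the pressure clause at `θ = 1/(n+1)`, and
`‖Ô‖ ≤ ∏ᵢ |z a⁴ Σ|fᵢ|| (‖Oᵢ‖ + |shift|) = e^{o(a_k L_k)}` is absorbed by `SubexponentialRenormalisation`; the normaliser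
`Str 𝕋^{2L_k+1} ≥ λ₀^{2L_k+1}(1 − ε) > 0` eventually (no junk branch). [difficulty: XL]
[cite: Luscher1977] [cite: MontvayMunster1994, §4.1.3 (4.34)] -/
def SchwingerReturn : Prop :=
  ∀ (Nf : ℕ) (sch : QCDScheme Nf) (Δth : ℝ), 0 < Δth →
    IsEventuallyPhysical sch → SubexponentialRenormalisation sch → LowTemperaturePressureAt sch Δth →
    ∀ n : ℕ, n ≠ 0 → ∀ (σ : Fin n → QCDField Nf) (f : Fin n → 𝓢(E4, ℝ)),
      Tendsto (fun k => qcdLatticeSchwinger sch k n σ f - qcdLatticeSchwingerThermal sch k n σ f) atTop (𝓝 0)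

/-- **Statement of stub 3 (THE RETURN for fixed observables; L/XL).**  Along an eventually physical scheme with low-temperature
pressure at rate `Δth > 0`, for every pair of gauge-invariant local lattice observables there is ONE constant such that eventually
in `k`, on every torus `S ≥ L_k` and at every separation `n ≤ S`, the twisted and thermal connected correlations differ by at most
`C e^{−Δth a_k (2S+1−n)}` — the twist/thermal defect decays in the length of the complementary arc (the statement's own "wrap-around
terms", QCDOS docstring of `HasLatticeMassGap`).  Proof route as for stub 2 with `Ô = Â 𝕋ⁿ B̂`, free stretch `2S+1−n−O(R)`, the pressure
clause at `θ = 1/2`, and no renormalisation constants (the coefficients of `A, B` are bounded by definition of `QCDLatticeObservable`);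
`F`-odd (baryonic) insertions make BOTH functionals vanish by `(−1)^F` superselection.  By-products worth registering as sub-goals:
`Str 𝕋^{2S+1} > 0` for `S ≥ L_k` eventually (normaliser of `qcdTorusExpect`; wanted by item 18328) and
`|⟨A⟩_P − ⟨A⟩_th| ≤ C e^{−Δth a_k(2S+1)}`. [difficulty: L/XL] [cite: Luscher1977] [cite: MontvayMunster1994, §4.1.3 (4.34)] -/
def CorrelatorReturn : Prop :=
  ∀ (Nf : ℕ) (sch : QCDScheme Nf) (Δth : ℝ), 0 < Δth →
    IsEventuallyPhysical sch → LowTemperaturePressureAt sch Δth →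
    ∀ (R R' : ℕ) (A : QCDLatticeObservable Nf R) (B : QCDLatticeObservable Nf R'), ∃ C : ℝ,
      ∀ᶠ k in atTop, ∀ S : ℕ, sch.L k ≤ S → ∀ n : ℕ, n ≤ S →
        ‖qcdLatticeConnectedCorr (sch.β k) (2 * S + 1) (fun fl => sch.mq fl k) A B n -
            qcdLatticeConnectedCorrThermal (sch.β k) (2 * S + 1) (fun fl => sch.mq fl k) A B n‖ ≤
          C * Real.exp (-(Δth * (sch.a k * (2 * S + 1 - n))))

/-- **Stub 1 (registered; OPEN PROBLEM — the lead's held stub).**  See `ThermalConstruction` / `ThermalQCDOf`. -/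
theorem stub_thermalQCD : ThermalConstruction := by
  sorry

/-- **Stub 2 (registered; XL).**  See `SchwingerReturn`. -/
theorem stub_schwingerComparison : SchwingerReturn := by
  sorry

/-- **Stub 3 (registered; L/XL — attack first).**  See `CorrelatorReturn`. -/
theorem stub_correlatorComparison : CorrelatorReturn := by
  sorry

/-! ## §6  Proved glue between the pieces -/

/-- **`IsQCDAlong` from `IsQCDAlongThermal` and the comparison of Schwinger functions** (`P = (P − th) + th`). [folklore] -/
theorem isQCDAlong_of_comparison {sch : QCDScheme Nf} {T : OSData (QCDField Nf) 4}
    (hcmp : ∀ n : ℕ, n ≠ 0 → ∀ (σ : Fin n → QCDField Nf) (f : Fin n → 𝓢(E4, ℝ)),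
      Tendsto (fun k => qcdLatticeSchwinger sch k n σ f - qcdLatticeSchwingerThermal sch k n σ f) atTop (𝓝 0))
    (h : IsQCDAlongThermal sch T) : IsQCDAlong sch T := by
  refine ⟨h.1, h.2.1, fun n hn σ f F hF hoff => ?_⟩
  have h1 := (hcmp n hn σ f).add (h.2.2 n hn σ f F hF hoff)
  rw [zero_add] at h1
  exact h1.congr' (Eventually.of_forall fun k => sub_add_cancel _ _)

/-- Exponential bookkeeping of the return: with `0 ≤ a`, `0 ≤ Δ'`, `Δ' ≤ Δ`, `0 ≤ x`, the bound at rate `Δ` is one at rate `Δ'`. [folklore] -/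
theorem exp_neg_mul_le_of_le {Δ Δ' a x : ℝ} (ha : 0 ≤ a) (hx : 0 ≤ x) (hle : Δ' ≤ Δ) :
    Real.exp (-(Δ * (a * x))) ≤ Real.exp (-(Δ' * (a * x))) :=
  Real.exp_le_exp.2 (by nlinarith [mul_nonneg ha hx])

/-- **The uniform lattice gap RETURNS at rate `min Δ Δth`**: if the thermal functional has the uniform gap `Δ` and the twisted and
thermal connected correlations differ by `C e^{−Δth a_k(2S+1−n)}` on all tori `S ≥ L_k`, `n ≤ S`, then the statement's functional has the
uniform gap `min Δ Δth` (`2S+1−n ≥ n` for `n ≤ S`). [folklore] -/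
theorem hasLatticeMassGap_of_comparison (sch : QCDScheme Nf) {Δ Δth : ℝ} (hΔ : 0 < Δ) (hΔth : 0 < Δth)
    (hcmp : ∀ (R R' : ℕ) (A : QCDLatticeObservable Nf R) (B : QCDLatticeObservable Nf R'), ∃ C : ℝ,
      ∀ᶠ k in atTop, ∀ S : ℕ, sch.L k ≤ S → ∀ n : ℕ, n ≤ S →
        ‖qcdLatticeConnectedCorr (sch.β k) (2 * S + 1) (fun fl => sch.mq fl k) A B n -
            qcdLatticeConnectedCorrThermal (sch.β k) (2 * S + 1) (fun fl => sch.mq fl k) A B n‖ ≤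
          C * Real.exp (-(Δth * (sch.a k * (2 * S + 1 - n)))))
    (hgap : HasThermalLatticeMassGap sch Δ) : sch.HasLatticeMassGap (min Δ Δth) := by
  intro R R' A B
  obtain ⟨C₁, h₁⟩ := hgap R R' A B
  obtain ⟨C₂, h₂⟩ := hcmp R R' A B
  refine ⟨max C₁ 0 + max C₂ 0, ?_⟩
  filter_upwards [h₁, h₂] with k hk₁ hk₂ S hS n hn
  have ha : 0 ≤ sch.a k := (sch.a_pos k).le
  have hn' : (n : ℝ) ≤ S := by exact_mod_cast hn
  have hδ₀ : 0 ≤ min Δ Δth := le_min hΔ.le hΔth.le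
  set P := qcdLatticeConnectedCorr (sch.β k) (2 * S + 1) (fun fl => sch.mq fl k) A B n
  set Q := qcdLatticeConnectedCorrThermal (sch.β k) (2 * S + 1) (fun fl => sch.mq fl k) A B n
  have hb₁ := hk₁ S hS n hn
  have hb₂ := hk₂ S hS n hn
  -- `‖P‖ ≤ ‖Q‖ + ‖P − Q‖`
  have htri : ‖P‖ ≤ ‖Q‖ + ‖P - Q‖ := by
    calc ‖P‖ = ‖Q + (P - Q)‖ := by rw [add_sub_cancel]
      _ ≤ ‖Q‖ + ‖P - Q‖ := norm_add_le _ _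
  -- the two exponentials at the common rate `min Δ Δth`
  have he₁ : Real.exp (-(Δ * (sch.a k * n))) ≤ Real.exp (-(min Δ Δth * (sch.a k * n))) :=
    exp_neg_mul_le_of_le ha (Nat.cast_nonneg n) (min_le_left _ _)
  have he₂ : Real.exp (-(Δth * (sch.a k * (2 * S + 1 - n)))) ≤ Real.exp (-(min Δ Δth * (sch.a k * n))) := by
    apply Real.exp_le_exp.2
    have h3 : (n : ℝ) ≤ 2 * S + 1 - n := by linarith
    have h4 : min Δ Δth * (sch.a k * n) ≤ Δth * (sch.a k * n) :=
      mul_le_mul_of_nonneg_right (min_le_right _ _) (mul_nonneg ha (Nat.cast_nonneg n))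
    have h5 : Δth * (sch.a k * n) ≤ Δth * (sch.a k * (2 * S + 1 - n)) :=
      mul_le_mul_of_nonneg_left (mul_le_mul_of_nonneg_left h3 ha) hΔth.le
    linarith
  have hq : ‖Q‖ ≤ max C₁ 0 * Real.exp (-(min Δ Δth * (sch.a k * n))) :=
    hb₁.trans ((mul_le_mul_of_nonneg_right (le_max_left _ _) (Real.exp_pos _).le).trans
      (mul_le_mul_of_nonneg_left he₁ (le_max_right _ _)))
  have hpq : ‖P - Q‖ ≤ max C₂ 0 * Real.exp (-(min Δ Δth * (sch.a k * n))) :=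
    hb₂.trans ((mul_le_mul_of_nonneg_right (le_max_left _ _) (Real.exp_pos _).le).trans
      (mul_le_mul_of_nonneg_left he₂ (le_max_right _ _)))
  calc ‖P‖ ≤ ‖Q‖ + ‖P - Q‖ := htri
    _ ≤ max C₁ 0 * Real.exp (-(min Δ Δth * (sch.a k * n))) +
          max C₂ 0 * Real.exp (-(min Δ Δth * (sch.a k * n))) := add_le_add hq hpq
    _ = (max C₁ 0 + max C₂ 0) * Real.exp (-(min Δ Δth * (sch.a k * n))) := by ring

/-- **The Goldstone bound RETURNS** (thermal ⇒ twisted, same rate, half the constant): the thermal lower bound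
`c e^{−μ a_k n_k} ≤ ‖corr_th‖`, the comparison `‖corr_P − corr_th‖ ≤ C e^{−Δth a_k(2S_k+1−n_k)}` and the dominance condition give
eventually `(c/2) e^{−μ a_k n_k} ≤ ‖corr_P‖`, i.e. the tree's `HasGoldstoneBoundAt` for the statement's functional. [folklore] -/
theorem hasGoldstoneBoundAt_of_thermal (reg : QCDRegularisation Nf) {ε : ℝ}
    (hcmp : CorrelatorReturn)
    (hG : HasThermalGoldstoneBoundAt reg ε) : reg.HasGoldstoneBoundAt ε := by
  obtain ⟨m, hm, μ, c, Δth, hμ, hc, hΔth, hphys, hLT, R, R', A, B, S, n, hLS, hnS, hdiv, hdom, hev⟩ := hG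
  obtain ⟨C, hC⟩ := hcmp Nf (reg.scheme m 0 0) Δth hΔth hphys hLT R R' A B
  refine ⟨m, hm, μ, c / 2, hμ, half_pos hc, R, R', A, B, S, n, hLS, hnS, hdiv, ?_⟩
  -- the comparison at `S_k`, `n_k` (the scheme `reg.scheme m 0 0` has the `a, β, L` of `reg`)
  have hC' : ∀ᶠ k in atTop,
      ‖qcdLatticeConnectedCorr (reg.β k) (2 * S k + 1) (fun fl => (reg.scheme m 0 0).mq fl k) A B (n k) -
          qcdLatticeConnectedCorrThermal (reg.β k) (2 * S k + 1) (fun fl => (reg.scheme m 0 0).mq fl k) A B (n k)‖ ≤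
        C * Real.exp (-(Δth * (reg.a k * (2 * S k + 1 - n k)))) :=
    hC.mono fun k hk => hk (S k) (hLS k) (n k) (hnS k)
  -- dominance: eventually the defect is at most half the signal
  have hsmall : ∀ᶠ k in atTop,
      max C 0 * Real.exp (-(Δth * (reg.a k * (2 * S k + 1 - n k)))) ≤
        c / 2 * Real.exp (-(μ * (reg.a k * n k))) := by
    have hpos : 0 < c / 2 / (max C 0 + 1) := div_pos (half_pos hc) (by positivity)
    filter_upwards [hdom.eventually (eventually_lt_nhds hpos)] with k hk
    have hE : 0 < Real.exp (-(μ * (reg.a k * n k))) := Real.exp_pos _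
    rw [div_lt_iff₀ hE] at hk
    have hne : max C 0 + 1 ≠ 0 := by positivity
    calc max C 0 * Real.exp (-(Δth * (reg.a k * (2 * S k + 1 - n k))))
        ≤ (max C 0 + 1) * Real.exp (-(Δth * (reg.a k * (2 * S k + 1 - n k)))) :=
          mul_le_mul_of_nonneg_right (by linarith) (Real.exp_pos _).le
      _ ≤ (max C 0 + 1) * (c / 2 / (max C 0 + 1) * Real.exp (-(μ * (reg.a k * n k)))) :=
          mul_le_mul_of_nonneg_left hk.le (by positivity)
      _ = c / 2 * Real.exp (-(μ * (reg.a k * n k))) := by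
          field_simp
  filter_upwards [hev, hC', hsmall] with k hk₁ hk₂ hk₃
  set P := qcdLatticeConnectedCorr (reg.β k) (2 * S k + 1) (fun fl => (reg.scheme m 0 0).mq fl k) A B (n k)
  set Q := qcdLatticeConnectedCorrThermal (reg.β k) (2 * S k + 1) (fun fl => (reg.scheme m 0 0).mq fl k) A B (n k)
  have htri : ‖Q‖ ≤ ‖P‖ + ‖P - Q‖ := by
    calc ‖Q‖ = ‖P - (P - Q)‖ := by rw [sub_sub_cancel]
      _ ≤ ‖P‖ + ‖P - Q‖ := norm_sub_le _ _
  have hdef : ‖P - Q‖ ≤ c / 2 * Real.exp (-(μ * (reg.a k * n k))) :=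
    hk₂.trans ((mul_le_mul_of_nonneg_right (le_max_left _ _) (Real.exp_pos _).le).trans hk₃)
  show c / 2 * Real.exp (-(μ * (reg.a k * n k))) ≤ ‖P‖
  linarith

/-- **The thermal Goldstone bound returns the Goldstone bound**, hence chirality at zero (tree `HasGoldstoneBound.isChiralAtZero`). [folklore] -/
theorem hasGoldstoneBound_of_thermal (reg : QCDRegularisation Nf)
    (hcmp : CorrelatorReturn)
    (hG : HasThermalGoldstoneBound reg) : reg.HasGoldstoneBound :=
  fun ε hε => hasGoldstoneBoundAt_of_thermal reg hcmp (hG ε hε)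

/-! ## §7  The composition -/

/-- **`QCDOf N_f` from the thermal conjunct and the two returns.**  Same regularisation, same species renormalisations, same OS
data; `IsChiralAtZero` from the returned Goldstone bound; `IsQCDAlong` from the Schwinger-function comparison; the returned lattice gap
at `min Δ Δ = Δ` is the conjunct's common rate for `T.HasMassGap` and `HasLatticeMassGap`. [folklore] -/
theorem qcdOf_of_thermal (hS : SchwingerReturn) (hC : CorrelatorReturn) (h : ThermalQCDOf Nf) : QCDOf Nf := by
  obtain ⟨reg, hms, hG, hall⟩ := h
  refine ⟨reg, hms, (hasGoldstoneBound_of_thermal reg hC hG).isChiralAtZero, fun m hm => ?_⟩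
  obtain ⟨z, shift, T, hphys, hren, hth, hnt, hng, hps, Δ, hΔ, hLT, hTgap, hLgap⟩ := hall m hm
  refine ⟨z, shift, T, isQCDAlong_of_comparison (hS Nf _ Δ hΔ hphys hren hLT) hth, hnt, hng, hps, Δ, hΔ, hTgap, ?_⟩
  have hmin := hasLatticeMassGap_of_comparison (reg.scheme m z shift) hΔ hΔ (hC Nf _ Δ hΔ hphys hLT) hLgap
  rwa [min_self] at hmin

/-- **The conjunct from the three stub STATEMENTS** (kernel-checked, sorry-free; hypotheses = `ThermalConstruction`,
`SchwingerReturn`, `CorrelatorReturn` verbatim): `QCD = QCDOf 2 ∧ QCDOf 3` by `qcdOf_of_thermal` at `N_f = 2, 3`. -/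
theorem qcd_of_returns : ThermalConstruction → SchwingerReturn → CorrelatorReturn → _root_.QCD :=
  fun hT hS hC => ⟨qcdOf_of_thermal hS hC (hT 2 (Or.inl rfl)), qcdOf_of_thermal hS hC (hT 3 (Or.inr rfl))⟩

/-- **The composition**: the registered stubs imply the crux `QuarksAsStableAction.StableActionBridge`, concluded BY NAME (the ONLY
theorem of this file with that conclusion, as the skeleton audit requires).  The bridge hypotheses A, S are discarded (theorems of
the tree); the body is `qcd_of_returns` applied to the three stubs — closed only by their three `sorry`s. -/
theorem StableActionBridge_of : StableActionBridge :=
  fun _ _ => qcd_of_returns stub_thermalQCD stub_schwingerComparison stub_correlatorComparison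


/-! ## §8  E3 — operator-level spectral representation of the two torus denominators
(lead c17, cycle 18: registered SUB-GOALS under stubs 2–3; none of them is a hypothesis of `StableActionBridge_of`)

Both returns compare the statement's time-PERIODIC torus functional (`qcdTorusExpect`, denominator = Berezin
orientation sign × cyclic kernel SUPERTRACE / `Z_W`, capstone `Sketch.integral_fermiBoltzmann_wilsonMeasure_eq_cyclic_supertrace`)
with the THERMAL one (`qcdTorusExpectAP`, denominator = sign × cyclic kernel TRACE / `Z_W`, capstone
`Sketch.integral_fermiBoltzmannAP_wilsonMeasure_eq_cyclic_trace`).  Step E3 of the crux's F3 roadmap turns these kernel-level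
cyclic integrals into spectral sums of ONE compact positive self-adjoint operator — Lüscher's transfer matrix realised on
`L²(SU(3)^{E₃} × Fock-index, Haar ⊗ count; ℂ)` (scalarised Fock-valued waves) with the Hermitian kernel
`k((U,s),(U',s')) = (R(U) · B(U,U') · R(U'))_{s s'}`, where `R(U)` is a continuous Hermitian square root of Smit's
`T̂_F(U) = fermionSliceOp U mq` and `B(U,U') = ∫ K_β(U, U'^g) Γ(G_g) dg` is the Gauss-averaged Wilson gauge kernel:

  `Z_W · ∫ ∫dψ̄dψ e^{−ψ̄ D^{AP} ψ} dμ_W = ε Σᵢ λᵢ^N`,   `Z_W · ∫ ∫dψ̄dψ e^{−ψ̄ D ψ} dμ_W = ε Σᵢ (−1)^{Fᵢ} λᵢ^N`,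
  `0 ≤ λᵢ ≤ λ_{i₀} = qcdTransferLevel N_f N β m 0`, `0 < λ_{i₀}`

(no trace class: unconditional sums over a countable joint eigenbasis of the transfer operator and fermion parity, as in the
pure-gauge `Literature.MathematicalPhysics.QuantumFieldTheory.exists_spectralData_wilsonTorusTransferMatrix`).  Consequences:
the thermal normaliser never vanishes (`Z_AP > 0`, no junk branch of `qcdTorusExpectAP`), the twisted one is
`λ_{i₀}^N (1 + O(Σ_{i ≠ i₀} (λᵢ/λ_{i₀})^N))`, and the thermal smallness / low-temperature pressure clause acquires its
spectral meaning (`Σᵢ λᵢ^t / λ_{i₀}^t − 1`).  Layer A below are the complex-scalar ports of the tree's REAL kernel files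
(`KernelPathIntegralPeeling`, `KernelCyclicPeeling`, `KernelIterateBridge`, `PositiveKernelSpectralTrace`); Layer B is the
QCD dictionary.  All statements are written WITHOUT new definitions (kernels spelled out), so that each lands as a
stand-alone `--supports` file. -/

section E3

open MeasureTheory
open scoped InnerProductSpace ComplexConjugate Matrix
open Literature.Probability.LatticeModels (TorusSite)

local notation "𝔾" => Matrix.specialUnitaryGroup (Fin 3) ℂ

/-! ### Landed sub-goals of wave 1 (cycle 18; imported above, formerly `sorry` stubs of this section)

* A1 `stub_cyclicPeelC` — `Theorems/…StubCyclicPeelC.lean` (p150886): complex cyclic peeling `∫ F(V0) G(Vp) ∏K = ∫ F·(κ-iterates)`.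
* A2 `stub_spectralTraceC` — `Theorems/…StubSpectralTraceC.lean` (p150910): `∫ F K^{(M+2)}(x,x) = Σᵢ λᵢ^{M+2} ∫ F |bᵢ|²` (Hermitian, no sign hypothesis).
* A3 `stub_inner_le_of_eigen_le` — `Theorems/…StubInnerLeOfEigenLe.lean` (p153845, lead): `Re ⟪v, A v⟫ ≤ Λ ‖v‖²` from an eigenbasis with `λᵢ ≤ Λ`.
* B1 `stub_fermionSliceOp_sqrt` — `Theorems/…StubFermionSliceOpSqrt.lean` (p151520): continuous Hermitian `R = CFC.sqrt T̂_F` in the bicommutant.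
* B2 `stub_bondKernel_star` — `Theorems/…StubBondKernelStar.lean` (p151396): `B(U',U)_{s's} = conj B(U,U')_{ss'}`.
* B3 `stub_bondKernel_continuous` — `Theorems/…StubBondKernelContinuous.lean` (p151825): joint continuity of `B`.
* B4 `stub_rayleigh_of_invariant` — `Theorems/…StubRayleighOfInvariant.lean` (p152324): on invariant waves the `k`-form of `RΨ` is
  `transferForm β mq Ψ Ψ`, its norm² is `fermionWeightForm mq Ψ Ψ`.
* B5 `stub_cyclic_scalarise` — `Theorems/…StubCyclicScalarise.lean` (p153405): both capstone cyclic integrals are cyclic integrals over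
  `Y = SU(3)^{E₃} × Finset(modes)` of the scalar kernel `k = (R B R)_{ss'}` (supertrace ↦ insertion `(−1)^{#(V 0).2}`).
* C6 `stub_scalarKernel_props` — `Theorems/…StubScalarKernelProps.lean` (p154900): `k` jointly continuous, strongly measurable, bounded,
  Hermitian, parity selection rule (helper `StubScalarKernelProps.parity_comm_fermionSliceOp`).
* C1 `stub_eigen_rayleigh` — `Theorems/…StubEigenRayleigh.lean` (p156476): eigenfunctions with `λ ≠ 0` are `RΨ`, `Ψ ∈ transferCore`,
  `𝔫 = ‖φ‖²`, `𝔱 = λ𝔫`, `transferRayleigh Ψ = λ`.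
* C2 `stub_rayleigh_le_of_eigen_le` — `Theorems/…StubRayleighLeOfEigenLe.lean` (p155282): `transferRayleigh Ψ ≤ Λ` if all eigenvalues `≤ Λ`
  (helpers `integral_prod_count`, `inner_toLp_eq_integral`, `ofReal_norm_toLp_sq`).
* C5 `stub_jointEigenbasis_involution` — `Theorems/…StubJointEigenbasisInvolution.lean` (p155034): parity-adapted eigenbasis.
* D1 `stub_mulInvolutionOp` — `Theorems/…StubMulInvolutionOp.lean` (p157156): `±1` weights as self-adjoint unitary involutions of `L²`
  commuting with intertwined kernel operators; `⟪φ, Fφ⟫ = ∫ w|φ|²`.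
* D2 `stub_exists_top_index` — `Theorems/…StubExistsTopIndex.lean` (p157054): square-summable family, least upper bound `> 0` attained.
* D3 `stub_levelZero_eq_eigenmax` — `Theorems/…StubLevelZeroEqEigenmax.lean` (p157105): eigenvalues `∈ [0, level 0]`, level 0 least bound.
* R1 `stub_denominator_comparison` — `Theorems/…StubDenominatorComparison.lean` (p157109): `|Z_tw − Z_th| ≤ 2 (Z_th − λ₀^N)` (first return
  lemma at the operator level, denominators).
* **D `stub_torusDenominators_spectral`** — `Theorems/…StubTorusDenominatorsSpectral.lean` (p157752, lead assembly): the E3 deliverable —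
  `ε Z_W Z_AP = Σᵢ λᵢ^N`, `ε Z_W Z_P = Σᵢ σᵢ λᵢ^N`, `0 ≤ λᵢ ≤ λ_{i₀} = qcdTransferLevel … 0`, `0 < λ_{i₀}`, `Σλᵢ² < ∞`, `σᵢ = ±1`, countable index.
* B5′ `stub_cyclic_scalarise_slices` — `Theorems/…StubCyclicScalariseSlices.lean` (p158581): `(m+2)`-slice traces on side `S` = cyclic integrals of `k`.
* Q2a `stub_modeNumber_selection` — `Theorems/…StubModeNumberSelection.lean` (p158561): `k` conserves the mode number.
* Q2b₁ `stub_fermionSliceMatrix_chargeConj` — `Theorems/…StubFermionSliceMatrixChargeConj.lean` (p159156): `A(Ū) = Aᵀ`,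
  `M_F(U)⁻ᵀ = (1 ⊗ w) M_F(Ū) (1 ⊗ w)ᴴ` with `w = chargeConj * γ₄`.
* Q2b₂ `stub_fockLift_complement` — `Theorems/…StubFockLiftComplement.lean` (p158888): `P_h Γ(M) P_hᴴ = det M · Γ(M⁻ᵀ)` (particle–hole).
* Q2c `stub_sliceData_suConj` — `Theorems/…StubSliceDataSuConj.lean` (p158909): gauge kernel / gauge action / Fock rotation / Haar are `suConj`-invariant.
* E1a `stub_spectralTraceInsertC` — `Theorems/…StubSpectralTraceInsertC.lean` (p159472): one- and two-BOND-insertion trace formulas (complex).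
* R2 `stub_numerator_comparison` — `Theorems/…StubNumeratorComparison.lean` (p159718): `|S_tw − S_th| ≤ 2 B_X B_X' λ₀^α (T − λ₀^β)`.
* **D′ `stub_thermalTraces_spectral`** — `Theorems/…StubThermalTracesSpectral.lean` (p160254, lead): the all-extent spectral representation
  of the thermal and twisted `(m+2)`-slice traces on side `S` over one parity-adapted eigenbasis (`λ_{i₀} = qcdTransferLevel … 0`).
* V1 `stub_fockGaugeAct_chargeConj` (p160966) · V2 `stub_fermionSliceOp_chargeConj` (p160847, `det M_F = 1`) · V3 `stub_bondKernel_chargeConj` (p160956) ·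
  V4 `stub_transferWave_chargeConj` (p161097) · V5a `stub_eigenvector_to_eigenwave` (p160905) · V5b `stub_eigenwave_to_eigenvector` (p160963) ·
  V7 `stub_simple_of_trace_lt` (p160793) — the charge-conjugation / eigenwave inputs of the vacuum-parity clause (files `Theorems/…Stub<Camel>.lean`).
* W6a `stub_eigenspace_simple` (p161574) · W6b `stub_sector_of_simple` (p161765) · W6c `stub_card_sliceFermiIdx` (p161604, `D₁ = 12 N_f S³`). -/

/-! ### Layer A — complex bounded kernels on a finite measure space -/




/-! ### Layer B — the QCD dictionary -/






/-! ### Wave 7 (cycle 18): sectors of eigenwaves, the charge-conjugation matrix — last inputs of the vacuum-parity clause -/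

/-- **Sub-goal W7a (registered stub `stub_wave_sector`): an eigenwave that vanishes a.e. off a mode-number sector after multiplication by
`R` vanishes EVERYWHERE off that sector** (and `R` itself preserves sectors).  (i) `R(U)` commutes with every diagonal function of `#s`
(bicommutant of `T̂_F`, which conserves `#s`), so it maps sector-`m`-supported vectors to such; (ii) from `(R(U)Ψ(U))_s = 0` for
`ρ`-a.e. `(U,s)` with `#s ≠ n₀` (`ρ = Haar ⊗ count` charges every `s`) one gets, for a.e. `U`, `Ψ(U)_s = 0` for all `#s ≠ n₀` (`R(U)`
invertible and sector preserving); then the eigenwave equation `λ Ψ(U) = ∫ B(U,U') T̂_F(U') Ψ(U') dU'` (whose kernel conserves `#s`) upgrades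
"a.e. `U`" to "every `U`" (`λ ≠ 0`).  With `n₀ > D₁` this says: `RΨ = 0` a.e. ⇒ `Ψ ≡ 0`. [folklore] -/
theorem stub_wave_sector : ∀ (Nf S : ℕ) [NeZero S] (β : ℝ) (mq : Fin Nf → ℝ), (∀ f, -1 < mq f) →
    ∀ R : GaugeConfig 3 S (Matrix.specialUnitaryGroup (Fin 3) ℂ) → Matrix (Finset (SliceFermiIdx Nf S)) (Finset (SliceFermiIdx Nf S)) ℂ,
    Continuous R → (∀ U, (R U)ᴴ = R U ∧ R U * R U = fermionSliceOp U mq ∧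
        ∀ P : Matrix (Finset (SliceFermiIdx Nf S)) (Finset (SliceFermiIdx Nf S)) ℂ,
          P * fermionSliceOp U mq = fermionSliceOp U mq * P → P * R U = R U * P) →
    (∀ (U : GaugeConfig 3 S (Matrix.specialUnitaryGroup (Fin 3) ℂ)) (v : Finset (SliceFermiIdx Nf S) → ℂ) (m : ℕ),
      (∀ s : Finset (SliceFermiIdx Nf S), s.card ≠ m → v s = 0) → ∀ s : Finset (SliceFermiIdx Nf S), s.card ≠ m → (R U *ᵥ v) s = 0) ∧
    ∀ (Ψ : SliceWave Nf S) (lam : ℝ) (n₀ : ℕ), Continuous Ψ → lam ≠ 0 →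
      (∀ (U : GaugeConfig 3 S (Matrix.specialUnitaryGroup (Fin 3) ℂ)) (a : Finset (SliceFermiIdx Nf S)),
        (∫ U', (((Matrix.of fun a' c => ∫ g : TorusSite 3 S → (Matrix.specialUnitaryGroup (Fin 3) ℂ),
            (gaugeSliceKernel β U (gaugeTransform g U') : ℂ) * @fockGaugeAct Nf S _ g a' c
              ∂(Measure.pi fun _ => haarProbability (Matrix.specialUnitaryGroup (Fin 3) ℂ))) * fermionSliceOp U' mq) *ᵥ Ψ U') a ∂(sliceHaar S)) = (lam : ℂ) * Ψ U a) →
      (∀ᵐ y ∂((sliceHaar S).prod (Measure.count : Measure (Finset (SliceFermiIdx Nf S)))),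
        y.2.card ≠ n₀ → (R y.1 *ᵥ Ψ y.1) y.2 = 0) →
      ∀ (U : GaugeConfig 3 S (Matrix.specialUnitaryGroup (Fin 3) ℂ)) (s : Finset (SliceFermiIdx Nf S)), s.card ≠ n₀ → Ψ U s = 0 := by
  sorry

/-- **Sub-goal W7b (registered stub `stub_chargeConjMatrix_sector`): the charge-conjugation matrix `𝒱 = P_hᴴ Γ(1 ⊗ w)` sends sector-`n₀`
vectors to sector-`(D₁ − n₀)` vectors** (`𝒱_{s t} = 0` unless `#s + #t = D₁`, `stub_fockGaugeAct_chargeConj` (c)). [folklore] -/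
theorem stub_chargeConjMatrix_sector : ∀ (Nf S : ℕ) [NeZero S] (v : Finset (SliceFermiIdx Nf S) → ℂ) (n₀ : ℕ),
    (∀ s : Finset (SliceFermiIdx Nf S), s.card ≠ n₀ → v s = 0) →
    ∀ s : Finset (SliceFermiIdx Nf S), s.card + n₀ ≠ Fintype.card (SliceFermiIdx Nf S) →
      (((particleHole (fun _ : SliceFermiIdx Nf S => (1 : ℂ)))ᴴ * fockLift (Matrix.reindex sliceQuarkEquiv sliceQuarkEquiv
        (sliceKron (1 : Matrix (SliceColourVar Nf S) (SliceColourVar Nf S) ℂ) (chargeConj * euclideanGamma 0)))) *ᵥ v) s = 0 := by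
  sorry

/-- **Sub-goal W7d (registered stub `stub_chargeConjMatrix_intertwine`): the charge-conjugation matrix `𝒱 = P_hᴴ Γ(1 ⊗ w)` is unitary and
intertwines the Fock gauge rotations and Smit's fermionic transfer operator with their charge conjugates** (`Γ(G_g) 𝒱 = 𝒱 Γ(G_ḡ)`,
`T̂_F(U) 𝒱 = 𝒱 T̂_F(Ū)`; from `stub_fockGaugeAct_chargeConj` (a),(b) and `stub_fermionSliceOp_chargeConj`). [folklore] -/
theorem stub_chargeConjMatrix_intertwine : ∀ (Nf S : ℕ) [NeZero S] (mq : Fin Nf → ℝ), (∀ f, -1 < mq f) →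
    (particleHole (fun _ : SliceFermiIdx Nf S => (1 : ℂ)))ᴴ * fockLift (Matrix.reindex sliceQuarkEquiv sliceQuarkEquiv
        (sliceKron (1 : Matrix (SliceColourVar Nf S) (SliceColourVar Nf S) ℂ) (chargeConj * euclideanGamma 0))) ∈ Matrix.unitaryGroup (Finset (SliceFermiIdx Nf S)) ℂ ∧
    (∀ g : TorusSite 3 S → (Matrix.specialUnitaryGroup (Fin 3) ℂ),
      @fockGaugeAct Nf S _ g * ((particleHole (fun _ : SliceFermiIdx Nf S => (1 : ℂ)))ᴴ * fockLift (Matrix.reindex sliceQuarkEquiv sliceQuarkEquiv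
        (sliceKron (1 : Matrix (SliceColourVar Nf S) (SliceColourVar Nf S) ℂ) (chargeConj * euclideanGamma 0)))) =
        ((particleHole (fun _ : SliceFermiIdx Nf S => (1 : ℂ)))ᴴ * fockLift (Matrix.reindex sliceQuarkEquiv sliceQuarkEquiv
        (sliceKron (1 : Matrix (SliceColourVar Nf S) (SliceColourVar Nf S) ℂ) (chargeConj * euclideanGamma 0)))) * @fockGaugeAct Nf S _ (fun x => suConj 3 (g x))) ∧
    (∀ U : GaugeConfig 3 S (Matrix.specialUnitaryGroup (Fin 3) ℂ),
      fermionSliceOp U mq * ((particleHole (fun _ : SliceFermiIdx Nf S => (1 : ℂ)))ᴴ * fockLift (Matrix.reindex sliceQuarkEquiv sliceQuarkEquiv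
        (sliceKron (1 : Matrix (SliceColourVar Nf S) (SliceColourVar Nf S) ℂ) (chargeConj * euclideanGamma 0)))) =
        ((particleHole (fun _ : SliceFermiIdx Nf S => (1 : ℂ)))ᴴ * fockLift (Matrix.reindex sliceQuarkEquiv sliceQuarkEquiv
        (sliceKron (1 : Matrix (SliceColourVar Nf S) (SliceColourVar Nf S) ℂ) (chargeConj * euclideanGamma 0)))) * fermionSliceOp (fun e => suConj 3 (U e)) mq) := by
  sorry

/-! ### Consequences of E3 (proved) -/

/-- **The thermal normaliser never vanishes**: for `β ≥ 0`, all `m_f > −1` and every torus `(ℤ/N)⁴`, `N ≥ 2`, the Wilson-measure average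
of the antiperiodic fermionic partition function is non-zero — `ε Z_W Z_AP = Σᵢ λᵢ^N ≥ λ_{i₀}^N > 0` by `stub_torusDenominators_spectral`
(no junk-`0` branch of `qcdTorusExpectAP`). [cite: Luscher1977, pp. 283–292] -/
theorem integral_fermiBoltzmannAP_ne_zero (Nf N : ℕ) [NeZero N] (hN : 2 ≤ N) (β : ℝ) (mq : Fin Nf → ℝ) (hβ : 0 ≤ β)
    (hm : ∀ f, -1 < mq f) :
    ∫ U : GaugeConfig 4 N 𝔾, fermiIntegral (fermiBoltzmannAP U mq)
        ∂(wilsonMeasure (d := 4) (L := N) (fundamentalRep (Fin 3)) β) ≠ 0 := by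
  obtain ⟨ι, _, lam, σ, i₀, hle, -, hpos, -, -, hsum, -⟩ := stub_torusDenominators_spectral Nf N hN β mq hβ hm
  intro h0
  rw [h0, mul_zero] at hsum
  -- the real sum of the non-negative terms `λᵢ^N` is `0`, contradicting `λ_{i₀}^N > 0`
  have hre : HasSum (fun i => lam i ^ N) 0 := by
    have h := Complex.reCLM.hasSum hsum
    simp only [Complex.reCLM_apply, Complex.zero_re] at h
    refine h.congr_fun fun i => ?_
    rw [← Complex.ofReal_pow, Complex.ofReal_re]
  have hle0 : lam i₀ ^ N ≤ 0 := le_hasSum hre i₀ fun j _ => pow_nonneg (hle j).1 N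
  exact absurd hle0 (not_le.2 (pow_pos hpos N))



end E3

end Summit.QuantumFields.QCD.Cruxes.StableActionBridge.TwistedTraceTransfer

end
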